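import Literature.ModelTheory.ExponentialFields.LastRootSeparation
import Literature.ModelTheory.ExponentialFields.CodeNewtonLetters
import HarnessLib

/-!
# The certificate system of the Last-Root decision procedure and its non-singular real zero

Family `periods` (periods.S26/S27), topic `Literature/ModelTheory/ExponentialFields`, in support of
the named fact
`Literature.ModelTheory.ExponentialFields.macintyreWilkie_realExpDecidable_iff_lastRootConjecture`
(`LastRootConjecture.lean`: `RealExpDecidable ↔ LastRootConjecture`, Macintyre–Wilkie 1996 as
reported by Berarducci–Servi 2004, p. 44).  Second file of the direction `←` (after
`LastRootSeparation.lean`).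

In Macintyre–Wilkie's decision procedure (in the rendering of Jones–Servi 2011, §3), the truth of
an existential sentence `∃x̄ P(x̄, e^{x̄}) = 0` is certified by a *non-singular* zero `ā` of a square
system `F` lying on `V(P)` (Wilkie's desingularisation), the existence of non-singular zeros
being transferable to all models of a weak true theory by Newton approximation
(`CodeNewtonSentences.lean`), while the vanishing of `P` at the zero is, under the Weak Schanuel /
Last Root Conjecture, equivalent to the *smallness* `θ |P(ā)| < 1` (`LastRootSeparation.lean`).
To push all of this through the Newton scheme, which only transfers the *existence of a zero of a
square system of codes*, this file writes the whole certificate as ONE square system of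
exponential-polynomial codes `Ĝ = certCode n F P η` in the `n + n² + 3` unknowns
`(x̄, B, u, w, t)`:

  `F(x̄) = 0`,  `B · JF(x̄) − 1 = 0` (code Jacobian `pdCode`),  `P(x̄) − u = 0`,  `η u − w = 0`,
  `t² − t² w² − 1 = 0`,

and proves (everything is proved; the only definitions are codes and index bookkeeping):

* `ExpPolyCode.cert_zero_iff` — in any commutative ring with a map `E`, a zero of `Ĝ` is exactly:
  a zero `x̄` of the rows of `F`, a matrix `B` with `B · JF(x̄) = 1`, `u = P(x̄)`, `w = η u`,
  `t² (1 − w²) = 1`; hence (`ExpPolyCode.of_cert_zero`, ordered fields) `η |P(x̄)| < 1`, and in `ℝ`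
  (`ExpPolyCode.of_cert_zero_real`) `det JF(x̄) ≠ 0` and `η |P(x̄)| < 1`;
* `ExpPolyCode.isNonsingularZero_certCode` — if `ā` is a zero of the rows of `F` with
  `det JF(ā) ≠ 0` and `P(ā) = 0`, then `(ā, JF(ā)⁻¹, 0, 0, 1)` (`ExpPolyCode.certPt`) is a
  **non-singular** zero of `Ĝ` (`ExpPolyCode.IsNonsingularZero`, the input of the Newton scheme):
  after reindexing the unknowns as `x̄ ⊕ (B ⊕ (u, w, t))` the Jacobian of `Ĝ` is block lower
  triangular with diagonal blocks `JF(ā)`, `blockDiagonal (JF(ā)ᵀ)` and a triangular `3 × 3`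
  block of determinant `2` (`ExpPolyCode.det_jac_certCode_ne_zero`);
* `ExpPolyCode.primrec_certCode` — `Ĝ` is a primitive recursive function of `(n, F, P, η)` (so
  that the scheme of certificate sentences is r.e., next file).

## References

* A. Macintyre, A. J. Wilkie, *On the decidability of the real exponential field*, in:
  Kreiseliana, A K Peters (1996), 441–467, §§4–5 (primary source not held).
* G. O. Jones, T. Servi, *On the decidability of the real field with a generic power function*,
  J. Symb. Log. 76 (2011), §3 (Lemma 3.5, Thm. 3.7, proof of Thm. 3.11).
* A. Berarducci, T. Servi, *An effective version of Wilkie's theorem of the complement and some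
  effective o-minimality results*, Ann. Pure Appl. Logic 125 (2004), p. 44.
-/

noncomputable section

open scoped BigOperators Matrix

namespace Literature.ModelTheory.ExponentialFields

namespace ExpPolyCode

/-! ### The certificate system: indices -/

section Cert

variable (n : ℕ)

/-- index of the unknown `b_{ik}` (as a natural number) [folklore] -/
def bIdx (i k : ℕ) : ℕ := n + (k + n * i)

/-- index of the unknown `u` [folklore] -/
def uIdx : ℕ := n + n * n

/-- index of the unknown `w` [folklore] -/
def wIdx : ℕ := n + (n * n + 1)

/-- index of the unknown `t` [folklore] -/
def tIdx : ℕ := n + (n * n + 2)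

variable {n}

/-- `k + n i < n²` for `i, k < n`. [folklore] -/
theorem add_mul_lt_mul_self {i k n : ℕ} (hi : i < n) (hk : k < n) : k + n * i < n * n := by
  have h1 : k + n * i < n * (i + 1) := by rw [Nat.mul_succ]; omega
  exact lt_of_lt_of_le h1 (Nat.mul_le_mul_left n hi)

/-- `bIdx` is a valid index. [folklore] -/
theorem bIdx_lt (i k : Fin n) : bIdx n i k < (n + (n * n + 3)) := by
  unfold bIdx
  have := add_mul_lt_mul_self i.is_lt k.is_lt
  omega

/-- `uIdx` is a valid index. [folklore] -/
theorem uIdx_lt : uIdx n < (n + (n * n + 3)) := by unfold uIdx; omega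
/-- `wIdx` is a valid index. [folklore] -/
theorem wIdx_lt : wIdx n < (n + (n * n + 3)) := by unfold wIdx; omega
/-- `tIdx` is a valid index. [folklore] -/
theorem tIdx_lt : tIdx n < (n + (n * n + 3)) := by unfold tIdx; omega

/-- the unknown `b_{ik}` as an element of `Fin (n + (n * n + 3))` [folklore] -/
def bFin (i k : Fin n) : Fin (n + (n * n + 3)) := ⟨bIdx n i k, bIdx_lt i k⟩
/-- the unknown `u` [folklore] -/
def uFin : Fin (n + (n * n + 3)) := ⟨uIdx n, uIdx_lt⟩
/-- the unknown `w` [folklore] -/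
def wFin : Fin (n + (n * n + 3)) := ⟨wIdx n, wIdx_lt⟩
/-- the unknown `t` [folklore] -/
def tFin : Fin (n + (n * n + 3)) := ⟨tIdx n, tIdx_lt⟩

/-- `bFin i k` is the extra unknown number `finProdFinEquiv (i, k)`. [folklore] -/
theorem bFin_eq (i k : Fin n) :
    bFin i k = Fin.natAdd n (Fin.castAdd 3 (finProdFinEquiv (i, k))) := by
  ext; simp [bFin, bIdx, finProdFinEquiv_apply_val]

/-- `u` is extra unknown number `n²`. [folklore] -/
theorem uFin_eq : (uFin : Fin (n + (n * n + 3))) = Fin.natAdd n (Fin.natAdd (n * n) (0 : Fin 3)) := by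
  ext; simp [uFin, uIdx]

/-- `w` is extra unknown number `n² + 1`. [folklore] -/
theorem wFin_eq : (wFin : Fin (n + (n * n + 3))) = Fin.natAdd n (Fin.natAdd (n * n) (1 : Fin 3)) := by
  ext; simp [wFin, wIdx]

/-- `t` is extra unknown number `n² + 2`. [folklore] -/
theorem tFin_eq : (tFin : Fin (n + (n * n + 3))) = Fin.natAdd n (Fin.natAdd (n * n) (2 : Fin 3)) := by
  ext; simp [tFin, tIdx]

variable (n) (F : List ExpPolyCode) (P : ExpPolyCode) (η : ℕ)

/-! ### The rows -/

/-- row `Fᵢ(x̄)` [folklore] -/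
def rowF (i : ℕ) : ExpPolyCode := liftCode n (n * n + 3) (F.getD i [])

/-- row `Σₖ b_{ik} ∂ⱼFₖ(x̄) − δᵢⱼ` (entry `(i, j)` of `B · JF(x̄) − 1`) [folklore] -/
def rowB (i j : ℕ) : ExpPolyCode :=
  ((List.range n).map fun k =>
      mulVarCode (n + (n * n + 3)) (bIdx n i k) (liftCode n (n * n + 3) (pdCode n j (F.getD k [])))).flatten ++
    if i = j then [(-1, [])] else []

/-- row `P(x̄) − u` [folklore] -/
def rowU : ExpPolyCode := liftCode n (n * n + 3) P ++ mulVarCode (n + (n * n + 3)) (uIdx n) [(-1, [])]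

/-- row `η u − w` (`η u` written as `u + ⋯ + u`, keeping all coefficients `±1`) [folklore] -/
def rowW : ExpPolyCode :=
  mulVarCode (n + (n * n + 3)) (uIdx n) ((List.range η).map fun _ => ((1 : ℤ), ([] : List ℕ))) ++
    mulVarCode (n + (n * n + 3)) (wIdx n) [(-1, [])]

/-- row `t² − t² w² − 1` [folklore] -/
def rowT : ExpPolyCode :=
  mulVarCode (n + (n * n + 3)) (tIdx n) (mulVarCode (n + (n * n + 3)) (tIdx n) [(1, [])]) ++
    mulVarCode (n + (n * n + 3)) (tIdx n) (mulVarCode (n + (n * n + 3)) (tIdx n)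
      (mulVarCode (n + (n * n + 3)) (wIdx n) (mulVarCode (n + (n * n + 3)) (wIdx n) [(-1, [])]))) ++ [(-1, [])]

/-- the `r`-th row of the certificate system [folklore] -/
def certRow (r : ℕ) : ExpPolyCode :=
  if r < n then rowF n F r
  else if r < n + n * n then rowB n F ((r - n) / n) ((r - n) % n)
  else if r = n + n * n then rowU n P
  else if r = n + (n * n + 1) then rowW n η
  else rowT n

/-- **The certificate system** `Ĝ(n, F, P, η)`: the square system of `n + n² + 3` codes
`F(x̄) = 0`, `B · JF(x̄) = 1`, `P(x̄) = u`, `η u = w`, `t² (1 − w²) = 1` in the unknowns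
`(x̄, B, u, w, t)`. A zero of it (in any ordered exponential field) is a zero `x̄` of `F` with
invertible Jacobian at which `η |P(x̄)| < 1`. [folklore] -/
def certCode : List ExpPolyCode := (List.range (n + (n * n + 3))).map (certRow n F P η)

/-- The certificate system is square. [folklore] -/
@[simp] theorem length_certCode : (certCode n F P η).length = (n + (n * n + 3)) := by simp [certCode]

/-- The rows of the certificate system. [folklore] -/
theorem getD_certCode {r : ℕ} (hr : r < (n + (n * n + 3))) : (certCode n F P η).getD r [] = certRow n F P η r := by
  rw [certCode, List.getD_eq_getElem?_getD, List.getElem?_map, List.getElem?_range hr]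
  rfl

/-- Row `x̄ᵢ`: `Fᵢ`. [folklore] -/
theorem certRow_castAdd (i : Fin n) : certRow n F P η (Fin.castAdd (n * n + 3) i) = rowF n F i := by
  simp [certRow, i.is_lt]

/-- Row `b_{ij}`: entry `(i, j)` of `B · JF − 1`. [folklore] -/
theorem certRow_bFin (i j : Fin n) : certRow n F P η (bFin i j) = rowB n F i j := by
  have h := add_mul_lt_mul_self i.is_lt j.is_lt
  have h1 : ¬ bIdx n i j < n := by unfold bIdx; omega
  have h2 : bIdx n i j < n + n * n := by unfold bIdx; omega
  have hi : (bIdx n i j - n) / n = i := by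
    unfold bIdx
    rw [Nat.add_sub_cancel_left, Nat.add_mul_div_left _ _ (by omega : 0 < n), Nat.div_eq_of_lt j.is_lt, zero_add]
  have hj : (bIdx n i j - n) % n = j := by
    unfold bIdx
    rw [Nat.add_sub_cancel_left, Nat.add_mul_mod_self_left, Nat.mod_eq_of_lt j.is_lt]
  simp only [certRow, bFin, h1, h2, if_false, if_true, hi, hj]

/-- Row `u`: `P − u`. [folklore] -/
theorem certRow_uFin : certRow n F P η (uFin (n := n)) = rowU n P := by
  simp [certRow, uFin, uIdx]

/-- Row `w`: `η u − w`. [folklore] -/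
theorem certRow_wFin : certRow n F P η (wFin (n := n)) = rowW n η := by
  simp [certRow, wFin, wIdx]

/-- Row `t`: `t² − t² w² − 1`. [folklore] -/
theorem certRow_tFin : certRow n F P η (tFin (n := n)) = rowT n := by
  simp [certRow, tFin, tIdx]

end Cert

end ExpPolyCode

namespace ExpPolyCode

/-! ### Semantics of the rows in a commutative ring with an `E` -/

section Semantics

variable {K : Type*} [CommRing K] (E : K → K) (n : ℕ) (F : List ExpPolyCode) (P : ExpPolyCode) (η : ℕ)

/-- the `x̄`-part of a tuple of all the unknowns `(x̄, B, u, w, t)` [folklore] -/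
def xOf {α : Type*} (y : Fin (n + (n * n + 3)) → α) : Fin n → α := fun i => y (Fin.castAdd (n * n + 3) i)

/-- Unfolding `xOf`. [folklore] -/
@[simp] theorem xOf_apply {α : Type*} (y : Fin (n + (n * n + 3)) → α) (i : Fin n) :
    xOf n y i = y (Fin.castAdd (n * n + 3) i) := rfl

/-- `evalWith` over a concatenation of codes. [folklore] -/
theorem evalWith_flatten (N : ℕ) (L : List ExpPolyCode) (y : Fin N → K) :
    evalWith E N L.flatten y = (L.map fun p => evalWith E N p y).sum := by
  induction L with
  | nil => simp [evalWith]
  | cons p L ih => rw [List.flatten_cons, evalWith_append, ih, List.map_cons, List.sum_cons]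

/-- Semantics of `rowF`: `Fᵢ(x̄)`. [folklore] -/
theorem evalWith_rowF (y : Fin (n + (n * n + 3)) → K) (i : ℕ) :
    evalWith E (n + (n * n + 3)) (rowF n F i) y = evalWith E n (F.getD i []) (xOf n y) :=
  evalWith_liftCode E n (n * n + 3) _ y

/-- Semantics of `rowB`: `Σₖ b_{ik} ∂ⱼFₖ(x̄) − δᵢⱼ`. [folklore] -/
theorem evalWith_rowB (y : Fin (n + (n * n + 3)) → K) (i j : Fin n) :
    evalWith E (n + (n * n + 3)) (rowB n F i j) y =
      (∑ k : Fin n, y (bFin i k) * evalWith E n (pdCode n j (F.getD k [])) (xOf n y)) -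
        (if i = j then 1 else 0) := by
  rw [rowB, evalWith_append, evalWith_flatten, List.map_map]
  have h1 : ((List.range n).map ((fun p => evalWith E (n + (n * n + 3)) p y) ∘ fun k =>
      mulVarCode (n + (n * n + 3)) (bIdx n i k) (liftCode n (n * n + 3) (pdCode n j (F.getD k []))))).sum =
      ∑ k : Fin n, y (bFin i k) * evalWith E n (pdCode n j (F.getD k [])) (xOf n y) := by
    rw [Fin.sum_univ_def, ← List.map_coe_finRange_eq_range, List.map_map]
    congr 1
    refine List.map_congr_left fun k _ => ?_
    simp only [Function.comp_apply]
    rw [evalWith_mulVarCode E _ (bIdx_lt i k), evalWith_liftCode]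
    rfl
  rw [h1, sub_eq_add_neg]
  congr 1
  by_cases hij : i = j
  · subst hij
    simp [evalWith]
  · have : (i : ℕ) ≠ j := fun h => hij (Fin.ext h)
    simp [hij, this, evalWith]

/-- Semantics of `rowU`: `P(x̄) − u`. [folklore] -/
theorem evalWith_rowU (y : Fin (n + (n * n + 3)) → K) :
    evalWith E (n + (n * n + 3)) (rowU n P) y = evalWith E n P (xOf n y) - y uFin := by
  rw [rowU, evalWith_append, evalWith_liftCode, evalWith_mulVarCode E _ uIdx_lt]
  simp [evalWith, sub_eq_add_neg]
  rfl

/-- Semantics of `rowW`: `η u − w`. [folklore] -/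
theorem evalWith_rowW (y : Fin (n + (n * n + 3)) → K) :
    evalWith E (n + (n * n + 3)) (rowW n η) y = (η : K) * y uFin - y wFin := by
  unfold uFin wFin
  rw [rowW, evalWith_append, evalWith_mulVarCode E _ uIdx_lt, evalWith_mulVarCode E _ wIdx_lt]
  simp [evalWith, sub_eq_add_neg, mul_comm, List.sum_replicate]

/-- Semantics of `rowT`: `t² − t² w² − 1`. [folklore] -/
theorem evalWith_rowT (y : Fin (n + (n * n + 3)) → K) :
    evalWith E (n + (n * n + 3)) (rowT n) y =
      y tFin * y tFin - y tFin * y tFin * (y wFin * y wFin) - 1 := by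
  unfold tFin wFin
  rw [rowT, evalWith_append, evalWith_append, evalWith_mulVarCode E _ tIdx_lt, evalWith_mulVarCode E _ tIdx_lt,
    evalWith_mulVarCode E _ tIdx_lt, evalWith_mulVarCode E _ tIdx_lt, evalWith_mulVarCode E _ wIdx_lt,
    evalWith_mulVarCode E _ wIdx_lt]
  simp [evalWith, sub_eq_add_neg]
  ring

/-- the matrix `B` read off a tuple of all the unknowns [folklore] -/
def bOf (y : Fin (n + (n * n + 3)) → K) : Matrix (Fin n) (Fin n) K := Matrix.of fun i k => y (bFin i k)

/-- the Jacobian matrix of `F` at `x̄` computed with the code derivatives, in `K` [folklore] -/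
def jacWith (x : Fin n → K) : Matrix (Fin n) (Fin n) K :=
  Matrix.of fun k j => evalWith E n (pdCode n j (F.getD k [])) x

/-- Every unknown is one of `x̄`, `B`, `u`, `w`, `t`. [folklore] -/
theorem fin_cases_cert (r : Fin (n + (n * n + 3))) :
    (∃ i : Fin n, r = Fin.castAdd (n * n + 3) i) ∨ (∃ i k : Fin n, r = bFin i k) ∨
      r = uFin ∨ r = wFin ∨ r = tFin := by
  refine Fin.addCases (fun i => Or.inl ⟨i, rfl⟩) (fun j => Or.inr ?_) r
  refine Fin.addCases (fun m => Or.inl ?_) (fun l => Or.inr ?_) j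
  · refine ⟨(finProdFinEquiv.symm m).1, (finProdFinEquiv.symm m).2, ?_⟩
    rw [bFin_eq, Prod.mk.eta, Equiv.apply_symm_apply]
  · fin_cases l
    · exact Or.inl (by rw [uFin_eq]; rfl)
    · exact Or.inr (Or.inl (by rw [wFin_eq]; rfl))
    · exact Or.inr (Or.inr (by rw [tFin_eq]; rfl))

/-- **What a zero of the certificate system is**, in any commutative ring with an `E`: a zero
`x̄` of the rows of `F`, a matrix `B` with `B · JF(x̄) = 1` (Jacobian by code derivatives),
`u = P(x̄)`, `w = η u` and `t² (1 − w²) = 1`. [folklore] -/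
theorem cert_zero_iff (y : Fin (n + (n * n + 3)) → K) :
    (∀ r : Fin (n + (n * n + 3)), evalWith E (n + (n * n + 3)) ((certCode n F P η).getD r []) y = 0) ↔
      (∀ i : Fin n, evalWith E n (F.getD i []) (xOf n y) = 0) ∧
        bOf n y * jacWith E n F (xOf n y) = 1 ∧
        y uFin = evalWith E n P (xOf n y) ∧ y wFin = (η : K) * y uFin ∧
        y tFin * y tFin * (1 - y wFin * y wFin) = 1 := by
  have hmat : bOf n y * jacWith E n F (xOf n y) = 1 ↔
      ∀ i j : Fin n, evalWith E (n + (n * n + 3)) (rowB n F i j) y = 0 := by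
    rw [← Matrix.ext_iff]
    refine forall_congr' fun i => forall_congr' fun j => ?_
    rw [evalWith_rowB, sub_eq_zero, Matrix.mul_apply, Matrix.one_apply]
    rfl
  constructor
  · intro h
    have hrow : ∀ r : Fin (n + (n * n + 3)), evalWith E _ (certRow n F P η r) y = 0 := fun r => by
      rw [← getD_certCode n F P η r.is_lt]; exact h r
    refine ⟨fun i => ?_, hmat.2 fun i j => ?_, ?_, ?_, ?_⟩
    · have := hrow (Fin.castAdd _ i); rwa [certRow_castAdd, evalWith_rowF] at this
    · have := hrow (bFin i j); rwa [certRow_bFin] at this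
    · have := hrow uFin; rw [certRow_uFin, evalWith_rowU, sub_eq_zero] at this; exact this.symm
    · have := hrow wFin; rw [certRow_wFin, evalWith_rowW, sub_eq_zero] at this; exact this.symm
    · have := hrow tFin; rw [certRow_tFin, evalWith_rowT] at this; linear_combination this
  · rintro ⟨hF, hB, hu, hw, ht⟩ r
    rw [getD_certCode n F P η r.is_lt]
    rcases fin_cases_cert n r with ⟨i, rfl⟩ | ⟨i, k, rfl⟩ | rfl | rfl | rfl
    · rw [certRow_castAdd, evalWith_rowF]; exact hF i
    · rw [certRow_bFin]; exact hmat.1 hB i k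
    · rw [certRow_uFin, evalWith_rowU, hu, sub_self]
    · rw [certRow_wFin, evalWith_rowW, hw, sub_self]
    · rw [certRow_tFin, evalWith_rowT]; linear_combination ht

end Semantics

end ExpPolyCode

namespace ExpPolyCode

/-! ### The non-singular real zero `(ā, JF(ā)⁻¹, 0, 0, 1)` of the certificate system -/

section RealZero

variable (n : ℕ) (F : List ExpPolyCode) (P : ExpPolyCode) (η : ℕ)

/-- Entries of the Jacobian matrix `jac`: code derivatives. [folklore] -/
theorem jac_apply (N : ℕ) (G : List ExpPolyCode) (x : Fin N → ℝ) (r c : Fin N) :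
    jac N G x r c = eval N (pdCode N c (G.getD r [])) x := by
  rw [jac_eq_jacFun, jacFun_rowTerm_eq, realize_pdRowTerm]

/-- In `ℝ`, `jacWith exp` is the Jacobian matrix `jac`. [folklore] -/
theorem jacWith_real (x : Fin n → ℝ) : jacWith Real.exp n F x = jac n F x := by
  ext k j
  rw [jacWith, Matrix.of_apply, evalWith_real, jac_apply]

/-- Jacobian entries as derivatives along coordinate lines. [folklore] -/
theorem jac_apply_of_hasDerivAt {N : ℕ} {G : List ExpPolyCode} {x : Fin N → ℝ} {r c : Fin N} {v : ℝ}
    (h : HasDerivAt (fun s => eval N (G.getD r []) (Function.update x c s)) v (x c)) : jac N G x r c = v := by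
  rw [jac_apply]
  exact (hasDerivAt_eval_update c x _).unique h

variable {n}

/-- Updating an extra unknown does not change `x̄`. [folklore] -/
theorem xOf_update_of_le {α : Type*} (y : Fin (n + (n * n + 3)) → α) {c : Fin (n + (n * n + 3))}
    (hc : n ≤ (c : ℕ)) (s : α) : xOf n (Function.update y c s) = xOf n y := by
  funext i
  simp only [xOf_apply]
  rw [Function.update_of_ne]
  intro h
  have := congrArg Fin.val h
  simp at this
  omega

/-- Updating `x_k`. [folklore] -/
theorem xOf_update_castAdd {α : Type*} (y : Fin (n + (n * n + 3)) → α) (k : Fin n) (s : α) :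
    xOf n (Function.update y (Fin.castAdd (n * n + 3) k) s) = Function.update (xOf n y) k s := by
  funext i
  simp only [xOf_apply]
  by_cases h : i = k
  · subst h; simp
  · rw [Function.update_of_ne (fun h' => h (Fin.castAdd_injective _ _ h')), Function.update_of_ne h, xOf_apply]

/-- The `B`-unknowns come after `x̄`. [folklore] -/
theorem le_bFin (i k : Fin n) : n ≤ ((bFin i k : Fin (n + (n * n + 3))) : ℕ) := by
  show n ≤ bIdx n i k; unfold bIdx; omega
/-- `u` comes after `x̄`. [folklore] -/
theorem le_uFin : n ≤ ((uFin : Fin (n + (n * n + 3))) : ℕ) := by show n ≤ uIdx n; unfold uIdx; omega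
/-- `w` comes after `x̄`. [folklore] -/
theorem le_wFin : n ≤ ((wFin : Fin (n + (n * n + 3))) : ℕ) := by show n ≤ wIdx n; unfold wIdx; omega
/-- `t` comes after `x̄`. [folklore] -/
theorem le_tFin : n ≤ ((tFin : Fin (n + (n * n + 3))) : ℕ) := by show n ≤ tIdx n; unfold tIdx; omega

/-- Distinct unknowns: `b_{ik} ≠ u`. [folklore] -/
theorem bFin_ne_uFin (i k : Fin n) : (bFin i k : Fin (n + (n * n + 3))) ≠ uFin := by
  intro h; have h' := congrArg Fin.val h
  have := add_mul_lt_mul_self i.is_lt k.is_lt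
  simp [bFin, uFin, bIdx, uIdx] at h'; omega
/-- Distinct unknowns: `b_{ik} ≠ w`. [folklore] -/
theorem bFin_ne_wFin (i k : Fin n) : (bFin i k : Fin (n + (n * n + 3))) ≠ wFin := by
  intro h; have h' := congrArg Fin.val h
  have := add_mul_lt_mul_self i.is_lt k.is_lt
  simp [bFin, wFin, bIdx, wIdx] at h'; omega
/-- Distinct unknowns: `b_{ik} ≠ t`. [folklore] -/
theorem bFin_ne_tFin (i k : Fin n) : (bFin i k : Fin (n + (n * n + 3))) ≠ tFin := by
  intro h; have h' := congrArg Fin.val h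
  have := add_mul_lt_mul_self i.is_lt k.is_lt
  simp [bFin, tFin, bIdx, tIdx] at h'; omega
/-- Distinct unknowns: `u ≠ w`. [folklore] -/
theorem uFin_ne_wFin : (uFin : Fin (n + (n * n + 3))) ≠ wFin := by
  intro h; have h' := congrArg Fin.val h; simp [uFin, wFin, uIdx, wIdx] at h'
/-- Distinct unknowns: `u ≠ t`. [folklore] -/
theorem uFin_ne_tFin : (uFin : Fin (n + (n * n + 3))) ≠ tFin := by
  intro h; have h' := congrArg Fin.val h; simp [uFin, tFin, uIdx, tIdx] at h'
/-- Distinct unknowns: `w ≠ t`. [folklore] -/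
theorem wFin_ne_tFin : (wFin : Fin (n + (n * n + 3))) ≠ tFin := by
  intro h; have h' := congrArg Fin.val h; simp [wFin, tFin, wIdx, tIdx] at h'

/-- `bFin` is injective in the pair `(i, k)`. [folklore] -/
theorem bFin_eq_bFin_iff (i k i' k' : Fin n) :
    (bFin i k : Fin (n + (n * n + 3))) = bFin i' k' ↔ i = i' ∧ k = k' := by
  constructor
  · intro h
    rw [bFin_eq, bFin_eq] at h
    have := finProdFinEquiv.injective (Fin.castAdd_injective _ _ (Fin.natAdd_injective _ _ h))
    exact ⟨congrArg Prod.fst this, congrArg Prod.snd this⟩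
  · rintro ⟨rfl, rfl⟩; rfl

variable (n)

/-- The rows of the certificate system as real functions: `Fᵢ(x̄)`. [folklore] -/
theorem eval_cert_castAdd (y : Fin (n + (n * n + 3)) → ℝ) (i : Fin n) :
    eval (n + (n * n + 3)) ((certCode n F P η).getD (Fin.castAdd (n * n + 3) i) []) y =
      eval n (F.getD i []) (xOf n y) := by
  rw [getD_certCode n F P η (Fin.castAdd (n * n + 3) i).is_lt, certRow_castAdd, ← evalWith_real, evalWith_rowF,
    evalWith_real]

/-- The rows of the certificate system as real functions: `(B · JF(x̄) − 1)ᵢⱼ`. [folklore] -/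
theorem eval_cert_bFin (y : Fin (n + (n * n + 3)) → ℝ) (i j : Fin n) :
    eval (n + (n * n + 3)) ((certCode n F P η).getD (bFin i j) []) y =
      (∑ k : Fin n, y (bFin i k) * eval n (pdCode n j (F.getD k [])) (xOf n y)) - (if i = j then 1 else 0) := by
  rw [getD_certCode n F P η (bFin i j).is_lt, certRow_bFin, ← evalWith_real, evalWith_rowB]
  simp only [evalWith_real]

/-- The rows of the certificate system as real functions: `P(x̄) − u`. [folklore] -/
theorem eval_cert_uFin (y : Fin (n + (n * n + 3)) → ℝ) :
    eval (n + (n * n + 3)) ((certCode n F P η).getD (uFin (n := n)) []) y = eval n P (xOf n y) - y uFin := by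
  rw [getD_certCode n F P η uFin.is_lt, certRow_uFin, ← evalWith_real, evalWith_rowU, evalWith_real]

/-- The rows of the certificate system as real functions: `η u − w`. [folklore] -/
theorem eval_cert_wFin (y : Fin (n + (n * n + 3)) → ℝ) :
    eval (n + (n * n + 3)) ((certCode n F P η).getD (wFin (n := n)) []) y = η * y uFin - y wFin := by
  rw [getD_certCode n F P η wFin.is_lt, certRow_wFin, ← evalWith_real, evalWith_rowW]

/-- The rows of the certificate system as real functions: `t² − t² w² − 1`. [folklore] -/
theorem eval_cert_tFin (y : Fin (n + (n * n + 3)) → ℝ) :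
    eval (n + (n * n + 3)) ((certCode n F P η).getD (tFin (n := n)) []) y =
      y tFin * y tFin - y tFin * y tFin * (y wFin * y wFin) - 1 := by
  rw [getD_certCode n F P η tFin.is_lt, certRow_tFin, ← evalWith_real, evalWith_rowT]

variable {F P η}
variable (a : Fin n → ℝ)

/-- **The real point** `(ā, JF(ā)⁻¹, 0, 0, 1)`. [folklore] -/
def certPt : Fin (n + (n * n + 3)) → ℝ :=
  Fin.append a (Fin.append (fun m => (jac n F a)⁻¹ (finProdFinEquiv.symm m).1 (finProdFinEquiv.symm m).2)
    ![0, 0, 1])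

/-- The `x̄`-part of the real point is `ā`. [folklore] -/
@[simp] theorem xOf_certPt : xOf n (certPt n (F := F) a) = a := by
  funext i; simp [certPt, xOf]

/-- The `B`-part of the real point is `JF(ā)⁻¹`. [folklore] -/
@[simp] theorem certPt_bFin (i k : Fin n) : certPt n (F := F) a (bFin i k) = (jac n F a)⁻¹ i k := by
  rw [bFin_eq, certPt, Fin.append_right, Fin.append_left, Equiv.symm_apply_apply]

/-- At the real point `u = 0`. [folklore] -/
@[simp] theorem certPt_uFin : certPt n (F := F) a uFin = 0 := by
  rw [uFin_eq, certPt, Fin.append_right, Fin.append_right]; rfl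

/-- At the real point `w = 0`. [folklore] -/
@[simp] theorem certPt_wFin : certPt n (F := F) a wFin = 0 := by
  rw [wFin_eq, certPt, Fin.append_right, Fin.append_right]; rfl

/-- At the real point `t = 1`. [folklore] -/
@[simp] theorem certPt_tFin : certPt n (F := F) a tFin = 1 := by
  rw [tFin_eq, certPt, Fin.append_right, Fin.append_right]; rfl

/-- The matrix `B` at the real point is `JF(ā)⁻¹`. [folklore] -/
@[simp] theorem bOf_certPt : bOf n (certPt n (F := F) a) = (jac n F a)⁻¹ := by
  ext i k; simp [bOf]

variable {a}
variable (hF : ∀ i : Fin n, eval n (F.getD i []) a = 0) (hJ : (jac n F a).det ≠ 0) (hP : eval n P a = 0)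
include hF hJ hP

/-- The real point is a zero of the certificate system. [folklore] -/
theorem sysMap_certCode_certPt : sysMap (n + (n * n + 3)) (certCode n F P η) (certPt n (F := F) a) = 0 := by
  funext r
  rw [sysMap, ← evalWith_real]
  refine (cert_zero_iff Real.exp n F P η (certPt n a)).2 ⟨?_, ?_, ?_, ?_, ?_⟩ r
  · intro i; rw [evalWith_real, xOf_certPt]; exact hF i
  · rw [xOf_certPt, jacWith_real, bOf_certPt]
    exact Matrix.nonsing_inv_mul _ (isUnit_iff_ne_zero.2 hJ)
  · rw [evalWith_real, xOf_certPt, hP, certPt_uFin]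
  · simp
  · simp

omit hF hJ hP in
/-- Jacobian block `(x̄-rows, x̄-columns)`: the Jacobian of `F`. [folklore] -/
theorem jac_cert_castAdd_castAdd (i k : Fin n) :
    jac (n + (n * n + 3)) (certCode n F P η) (certPt n (F := F) a) (Fin.castAdd _ i) (Fin.castAdd _ k) =
      jac n F a i k := by
  refine jac_apply_of_hasDerivAt ?_
  simp only [eval_cert_castAdd, xOf_update_castAdd, xOf_certPt]
  rw [jac_apply]
  have h := hasDerivAt_eval_update k a (F.getD i [])
  have : certPt n (F := F) a (Fin.castAdd (n * n + 3) k) = a k := by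
    have := congrFun (xOf_certPt n (F := F) a) k; simpa using this
  rw [this]
  exact h

omit hF hJ hP in
/-- Jacobian block `(x̄-rows, extra columns)`: zero. [folklore] -/
theorem jac_cert_castAdd_of_le (i : Fin n) {c : Fin (n + (n * n + 3))} (hc : n ≤ (c : ℕ)) :
    jac (n + (n * n + 3)) (certCode n F P η) (certPt n (F := F) a) (Fin.castAdd _ i) c = 0 := by
  refine jac_apply_of_hasDerivAt ?_
  simp only [eval_cert_castAdd, xOf_update_of_le _ hc]
  exact hasDerivAt_const _ _

omit hF hJ hP in
/-- Jacobian block `(B-rows, extra columns)`. [folklore] -/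
theorem jac_cert_bFin_of_le (i j : Fin n) {c : Fin (n + (n * n + 3))} (hc : n ≤ (c : ℕ)) :
    jac (n + (n * n + 3)) (certCode n F P η) (certPt n (F := F) a) (bFin i j) c =
      ∑ k : Fin n, if bFin i k = c then jac n F a k j else 0 := by
  refine jac_apply_of_hasDerivAt ?_
  simp only [eval_cert_bFin, xOf_update_of_le _ hc, xOf_certPt]
  refine HasDerivAt.sub_const _ (HasDerivAt.fun_sum fun k _ => ?_)
  rw [jac_apply]
  by_cases h : bFin i k = c
  · rw [if_pos h, ← h]
    simp only [Function.update_self]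
    simpa using (hasDerivAt_id (certPt n (F := F) a (bFin i k))).mul_const (eval n (pdCode n j (F.getD k [])) a)
  · rw [if_neg h]
    simp only [Function.update_of_ne h]
    exact hasDerivAt_const _ _

omit hF hJ hP in
/-- Jacobian block `(B-rows, B-columns)`: `δ_{ii'} ∂ⱼF_{k'}(ā)`. [folklore] -/
theorem jac_cert_bFin_bFin (i j i' k' : Fin n) :
    jac (n + (n * n + 3)) (certCode n F P η) (certPt n (F := F) a) (bFin i j) (bFin i' k') =
      if i = i' then jac n F a k' j else 0 := by
  rw [jac_cert_bFin_of_le n i j (le_bFin i' k')]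
  simp only [bFin_eq_bFin_iff]
  by_cases hi : i = i'
  · subst hi; simp
  · simp [hi]

omit hF hJ hP in
/-- Jacobian block `(B-rows, (u, w, t)-columns)`: zero. [folklore] -/
theorem jac_cert_bFin_eq_zero (i j : Fin n) {c : Fin (n + (n * n + 3))} (hc : n ≤ (c : ℕ))
    (hne : ∀ k : Fin n, bFin i k ≠ c) :
    jac (n + (n * n + 3)) (certCode n F P η) (certPt n (F := F) a) (bFin i j) c = 0 := by
  rw [jac_cert_bFin_of_le n i j hc]
  exact Finset.sum_eq_zero fun k _ => if_neg (hne k)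

omit hF hJ hP in
/-- Jacobian entry `(u, u)`: `−1`. [folklore] -/
theorem jac_cert_uFin_uFin :
    jac (n + (n * n + 3)) (certCode n F P η) (certPt n (F := F) a) uFin uFin = -1 := by
  refine jac_apply_of_hasDerivAt ?_
  simp only [eval_cert_uFin, xOf_update_of_le _ le_uFin, Function.update_self]
  simpa using (hasDerivAt_id _).const_sub (eval n P (xOf n (certPt n (F := F) a)))

omit hF hJ hP in
/-- Jacobian entry `(u, w)`: `0`. [folklore] -/
theorem jac_cert_uFin_wFin :
    jac (n + (n * n + 3)) (certCode n F P η) (certPt n (F := F) a) uFin wFin = 0 := by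
  refine jac_apply_of_hasDerivAt ?_
  simp only [eval_cert_uFin, xOf_update_of_le _ le_wFin, Function.update_of_ne uFin_ne_wFin]
  exact hasDerivAt_const _ _

omit hF hJ hP in
/-- Jacobian entry `(u, t)`: `0`. [folklore] -/
theorem jac_cert_uFin_tFin :
    jac (n + (n * n + 3)) (certCode n F P η) (certPt n (F := F) a) uFin tFin = 0 := by
  refine jac_apply_of_hasDerivAt ?_
  simp only [eval_cert_uFin, xOf_update_of_le _ le_tFin, Function.update_of_ne uFin_ne_tFin]
  exact hasDerivAt_const _ _

omit hF hJ hP in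
/-- Jacobian entry `(w, w)`: `−1`. [folklore] -/
theorem jac_cert_wFin_wFin :
    jac (n + (n * n + 3)) (certCode n F P η) (certPt n (F := F) a) wFin wFin = -1 := by
  refine jac_apply_of_hasDerivAt ?_
  simp only [eval_cert_wFin, Function.update_self, Function.update_of_ne uFin_ne_wFin]
  simpa using (hasDerivAt_id _).const_sub ((η : ℝ) * certPt n (F := F) a uFin)

omit hF hJ hP in
/-- Jacobian entry `(w, t)`: `0`. [folklore] -/
theorem jac_cert_wFin_tFin :
    jac (n + (n * n + 3)) (certCode n F P η) (certPt n (F := F) a) wFin tFin = 0 := by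
  refine jac_apply_of_hasDerivAt ?_
  simp only [eval_cert_wFin, Function.update_of_ne uFin_ne_tFin, Function.update_of_ne wFin_ne_tFin]
  exact hasDerivAt_const _ _

omit hF hJ hP in
/-- Jacobian entry `(t, t)`: `2`. [folklore] -/
theorem jac_cert_tFin_tFin :
    jac (n + (n * n + 3)) (certCode n F P η) (certPt n (F := F) a) tFin tFin = 2 := by
  refine jac_apply_of_hasDerivAt ?_
  simp only [eval_cert_tFin, Function.update_self, Function.update_of_ne wFin_ne_tFin, certPt_wFin, certPt_tFin,
    mul_zero, sub_zero]
  have h := ((hasDerivAt_id (1 : ℝ)).mul (hasDerivAt_id (1 : ℝ))).sub_const (1 : ℝ)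
  refine h.congr_deriv ?_
  norm_num

omit hF hP in
/-- **The Jacobian determinant of the certificate system at the real point is non-zero**:
after reindexing the unknowns as `x̄ ⊕ (B ⊕ (u, w, t))` the Jacobian is block lower
triangular with diagonal blocks `JF(ā)`, `blockDiagonal (JF(ā)ᵀ)` and a lower triangular
`3 × 3` block with diagonal `(−1, −1, 2)`. [folklore] -/
theorem det_jac_certCode_ne_zero :
    (jac (n + (n * n + 3)) (certCode n F P η) (certPt n (F := F) a)).det ≠ 0 := by
  set J := jac (n + (n * n + 3)) (certCode n F P η) (certPt n (F := F) a) with hJdef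
  -- first split: `x̄ ⊕ rest`
  set M₁ : Matrix (Fin n ⊕ Fin (n * n + 3)) (Fin n ⊕ Fin (n * n + 3)) ℝ :=
    Matrix.reindex finSumFinEquiv.symm finSumFinEquiv.symm J with hM₁
  have hdet₁ : J.det = M₁.det := (Matrix.det_reindex_self finSumFinEquiv.symm J).symm
  have hM₁e : ∀ p q, M₁ p q = J (finSumFinEquiv p) (finSumFinEquiv q) := fun p q => by
    simp [hM₁, Matrix.reindex_apply, Matrix.submatrix_apply]
  have h12 : M₁.toBlocks₁₂ = 0 := by
    ext i j
    rw [Matrix.toBlocks₁₂, Matrix.of_apply, hM₁e, finSumFinEquiv_apply_left, finSumFinEquiv_apply_right]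
    exact jac_cert_castAdd_of_le n i (by simp)
  have h11 : M₁.toBlocks₁₁ = jac n F a := by
    ext i k
    rw [Matrix.toBlocks₁₁, Matrix.of_apply, hM₁e, finSumFinEquiv_apply_left, finSumFinEquiv_apply_left]
    exact jac_cert_castAdd_castAdd n i k
  have hM₁b : M₁ = Matrix.fromBlocks (jac n F a) 0 M₁.toBlocks₂₁ M₁.toBlocks₂₂ := by
    rw [← h11, ← h12, Matrix.fromBlocks_toBlocks]
  -- second split of the rest: `B ⊕ (u, w, t)`
  set D := M₁.toBlocks₂₂ with hD
  have hDe : ∀ p q : Fin (n * n + 3), D p q = J (Fin.natAdd n p) (Fin.natAdd n q) := fun p q => by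
    rw [hD, Matrix.toBlocks₂₂, Matrix.of_apply, hM₁e, finSumFinEquiv_apply_right, finSumFinEquiv_apply_right]
  set M₂ : Matrix (Fin (n * n) ⊕ Fin 3) (Fin (n * n) ⊕ Fin 3) ℝ :=
    Matrix.reindex finSumFinEquiv.symm finSumFinEquiv.symm D with hM₂
  have hdet₂ : D.det = M₂.det := (Matrix.det_reindex_self finSumFinEquiv.symm D).symm
  have hM₂e : ∀ p q, M₂ p q = D (finSumFinEquiv p) (finSumFinEquiv q) := fun p q => by
    simp [hM₂, Matrix.reindex_apply, Matrix.submatrix_apply]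
  -- names of the extra unknowns
  have hb : ∀ m : Fin (n * n), Fin.natAdd n (Fin.castAdd 3 m) =
      (bFin (finProdFinEquiv.symm m).1 (finProdFinEquiv.symm m).2 : Fin (n + (n * n + 3))) := fun m => by
    rw [bFin_eq, Prod.mk.eta, Equiv.apply_symm_apply]
  have hu : Fin.natAdd n (Fin.natAdd (n * n) (0 : Fin 3)) = (uFin : Fin (n + (n * n + 3))) := uFin_eq.symm
  have hw : Fin.natAdd n (Fin.natAdd (n * n) (1 : Fin 3)) = (wFin : Fin (n + (n * n + 3))) := wFin_eq.symm
  have ht : Fin.natAdd n (Fin.natAdd (n * n) (2 : Fin 3)) = (tFin : Fin (n + (n * n + 3))) := tFin_eq.symm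
  have h12' : M₂.toBlocks₁₂ = 0 := by
    ext m l
    rw [Matrix.toBlocks₁₂, Matrix.of_apply, hM₂e, finSumFinEquiv_apply_left, finSumFinEquiv_apply_right, hDe, hb]
    fin_cases l
    · simp only [Fin.zero_eta, hu]
      exact jac_cert_bFin_eq_zero n _ _ le_uFin fun k => bFin_ne_uFin _ k
    · simp only [Fin.mk_one, hw]
      exact jac_cert_bFin_eq_zero n _ _ le_wFin fun k => bFin_ne_wFin _ k
    · show J _ (Fin.natAdd n (Fin.natAdd (n * n) (2 : Fin 3))) = 0
      rw [ht]
      exact jac_cert_bFin_eq_zero n _ _ le_tFin fun k => bFin_ne_tFin _ k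
  -- the `B`-block is `blockDiagonal (JF(ā)ᵀ)` after reindexing by `m ↦ (j, i)`
  set e₃ : Fin (n * n) ≃ Fin n × Fin n := finProdFinEquiv.symm.trans (Equiv.prodComm _ _) with he₃
  have h11' : Matrix.reindex e₃ e₃ M₂.toBlocks₁₁ = Matrix.blockDiagonal fun _ : Fin n => (jac n F a).transpose := by
    ext ⟨j, i⟩ ⟨k', i'⟩
    rw [Matrix.reindex_apply, Matrix.submatrix_apply, Matrix.blockDiagonal_apply', Matrix.toBlocks₁₁,
      Matrix.of_apply, hM₂e, finSumFinEquiv_apply_left, finSumFinEquiv_apply_left, hDe, hb, hb]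
    simp only [he₃, Equiv.symm_trans_apply, Equiv.prodComm_symm, Equiv.prodComm_apply, Prod.swap_prod_mk,
      Equiv.symm_symm, Equiv.symm_apply_apply, Matrix.transpose_apply]
    exact jac_cert_bFin_bFin n i j i' k'
  have hdet11' : M₂.toBlocks₁₁.det = (jac n F a).det ^ n := by
    rw [← Matrix.det_reindex_self e₃, h11', Matrix.det_blockDiagonal]
    simp [Matrix.det_transpose]
  -- the `(u, w, t)`-block is lower triangular with diagonal `(-1, -1, 2)`
  have hdet22' : M₂.toBlocks₂₂.det = 2 := by
    have e : ∀ l l' : Fin 3, M₂.toBlocks₂₂ l l' =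
        J (Fin.natAdd n (Fin.natAdd (n * n) l)) (Fin.natAdd n (Fin.natAdd (n * n) l')) := fun l l' => by
      rw [Matrix.toBlocks₂₂, Matrix.of_apply, hM₂e, finSumFinEquiv_apply_right, finSumFinEquiv_apply_right, hDe]
    rw [Matrix.det_fin_three]
    simp only [e, hu, hw, ht, hJdef]
    rw [jac_cert_uFin_uFin, jac_cert_uFin_wFin, jac_cert_uFin_tFin, jac_cert_wFin_wFin, jac_cert_wFin_tFin,
      jac_cert_tFin_tFin]
    ring
  have hM₂b : M₂ = Matrix.fromBlocks M₂.toBlocks₁₁ 0 M₂.toBlocks₂₁ M₂.toBlocks₂₂ := by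
    rw [← h12', Matrix.fromBlocks_toBlocks]
  -- assemble
  rw [hdet₁, hM₁b, Matrix.det_fromBlocks_zero₁₂, hdet₂, hM₂b, Matrix.det_fromBlocks_zero₁₂, hdet11', hdet22']
  exact mul_ne_zero hJ (mul_ne_zero (pow_ne_zero _ hJ) two_ne_zero)

/-- **The certificate system has a non-singular real zero** as soon as `ā` is a zero of the rows
of `F` with invertible Jacobian and `P(ā) = 0`: the point `(ā, JF(ā)⁻¹, 0, 0, 1)`. [folklore] -/
theorem isNonsingularZero_certCode :
    IsNonsingularZero (n + (n * n + 3)) (certCode n F P η) (certPt n (F := F) a) := by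
  refine ⟨length_certCode n F P η, sysMap_certCode_certPt n hF hJ hP, ?_⟩
  rw [det_fderiv_sysMap]
  exact det_jac_certCode_ne_zero n hJ

end RealZero

end ExpPolyCode

namespace ExpPolyCode

/-! ### What a zero of the certificate system gives, in an ordered field and in `ℝ` -/

section Extraction

/-- `t² (1 − w²) = 1` forces `|w| < 1` in an ordered field. [folklore] -/
theorem abs_lt_one_of_cert {K : Type*} [Field K] [LinearOrder K] [IsStrictOrderedRing K] {t w : K}
    (h : t * t * (1 - w * w) = 1) : |w| < 1 := by
  have hpos : 0 < 1 - w * w := by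
    by_contra hle
    have : t * t * (1 - w * w) ≤ 0 := mul_nonpos_of_nonneg_of_nonpos (mul_self_nonneg t) (not_lt.1 hle)
    rw [h] at this
    exact absurd this (not_le.2 one_pos)
  have hw : w ^ 2 < 1 := by nlinarith
  exact (sq_lt_one_iff_abs_lt_one w).1 hw

variable {K : Type*} [Field K] [LinearOrder K] [IsStrictOrderedRing K] (E : K → K)
  (n : ℕ) (F : List ExpPolyCode) (P : ExpPolyCode) (η : ℕ)

/-- **A zero of the certificate system in an ordered field with an `E`** gives a zero `x̄` of
the rows of `F` with invertible (code) Jacobian at which `η |P(x̄)| < 1`. [folklore] -/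
theorem of_cert_zero {y : Fin (n + (n * n + 3)) → K}
    (hy : ∀ r : Fin (n + (n * n + 3)), evalWith E (n + (n * n + 3)) ((certCode n F P η).getD r []) y = 0) :
    (∀ i : Fin n, evalWith E n (F.getD i []) (xOf n y) = 0) ∧
      bOf n y * jacWith E n F (xOf n y) = 1 ∧ (η : K) * |evalWith E n P (xOf n y)| < 1 := by
  obtain ⟨hF, hB, hu, hw, ht⟩ := (cert_zero_iff E n F P η y).1 hy
  refine ⟨hF, hB, ?_⟩
  have h := abs_lt_one_of_cert ht
  rw [hw, hu, abs_mul, Nat.abs_cast] at h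
  exact h

/-- **In `ℝ`**: a zero of the certificate system gives `ā = x̄` with `F(ā) = 0`, `det JF(ā) ≠ 0`
and `η |P(ā)| < 1`. [folklore] -/
theorem of_cert_zero_real {y : Fin (n + (n * n + 3)) → ℝ}
    (hy : ∀ r : Fin (n + (n * n + 3)), eval (n + (n * n + 3)) ((certCode n F P η).getD r []) y = 0) :
    (∀ i : Fin n, eval n (F.getD i []) (xOf n y) = 0) ∧ (jac n F (xOf n y)).det ≠ 0 ∧
      (η : ℝ) * |eval n P (xOf n y)| < 1 := by
  have hy' : ∀ r : Fin (n + (n * n + 3)),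
      evalWith Real.exp (n + (n * n + 3)) ((certCode n F P η).getD r []) y = 0 := fun r => by
    rw [evalWith_real]; exact hy r
  obtain ⟨hF, hB, hP⟩ := of_cert_zero Real.exp n F P η hy'
  refine ⟨fun i => by rw [← evalWith_real]; exact hF i, ?_, by rwa [evalWith_real] at hP⟩
  rw [jacWith_real] at hB
  exact Matrix.det_ne_zero_of_left_inverse hB

end Extraction

/-! ### Computability of the certificate system -/

section Computability

open Primrec

/-- `rowF` is primitive recursive in `(n, F, i)`. [folklore] -/
theorem primrec_rowF : Primrec fun p : (ℕ × List ExpPolyCode) × ℕ => rowF p.1.1 p.1.2 p.2 := by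
  unfold rowF
  exact primrec_liftCode.comp (pair (fst.comp fst) (pair
    (nat_add.comp (nat_mul.comp (fst.comp fst) (fst.comp fst)) (const 3))
    ((list_getD ([] : ExpPolyCode)).comp (snd.comp fst) snd)))

/-- the dimension `n + (n² + 3)` is primitive recursive [folklore] -/
theorem primrec_certDim : Primrec fun n : ℕ => n + (n * n + 3) :=
  nat_add.comp Primrec.id (nat_add.comp (nat_mul.comp Primrec.id Primrec.id) (const 3))

/-- `rowB` is primitive recursive in `(n, F, i, j)`. [folklore] -/
theorem primrec_rowB : Primrec fun p : (ℕ × List ExpPolyCode) × ℕ × ℕ => rowB p.1.1 p.1.2 p.2.1 p.2.2 := by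
  unfold rowB
  have hn : Primrec fun p : (ℕ × List ExpPolyCode) × ℕ × ℕ => p.1.1 := fst.comp fst
  have hF : Primrec fun p : (ℕ × List ExpPolyCode) × ℕ × ℕ => p.1.2 := snd.comp fst
  have hi : Primrec fun p : (ℕ × List ExpPolyCode) × ℕ × ℕ => p.2.1 := fst.comp snd
  have hj : Primrec fun p : (ℕ × List ExpPolyCode) × ℕ × ℕ => p.2.2 := snd.comp snd
  refine list_append.comp (list_flatten.comp (list_map (list_range.comp hn) ?_)) ?_
  · -- k ↦ mulVarCode N (bIdx n i k) (liftCode n (n²+3) (pdCode n j (F.getD k [])))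
    have hn' : Primrec fun q : ((ℕ × List ExpPolyCode) × ℕ × ℕ) × ℕ => q.1.1.1 := hn.comp fst
    have hb : Primrec fun q : ((ℕ × List ExpPolyCode) × ℕ × ℕ) × ℕ => bIdx q.1.1.1 q.1.2.1 q.2 := by
      unfold bIdx
      exact nat_add.comp hn' (nat_add.comp snd (nat_mul.comp hn' (hi.comp fst)))
    have hl : Primrec fun q : ((ℕ × List ExpPolyCode) × ℕ × ℕ) × ℕ =>
        liftCode q.1.1.1 (q.1.1.1 * q.1.1.1 + 3) (pdCode q.1.1.1 q.1.2.2 (q.1.1.2.getD q.2 [])) := by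
      refine primrec_liftCode.comp (pair hn' (pair (nat_add.comp (nat_mul.comp hn' hn') (const 3)) ?_))
      exact primrec_pdCode.comp (pair hn' (pair (hj.comp fst)
        ((list_getD ([] : ExpPolyCode)).comp (hF.comp fst) snd)))
    exact (primrec_mulVarCode.comp (pair (primrec_certDim.comp hn') (pair hb hl))).to₂
  · exact ite (Primrec.eq.comp hi hj) (const [((-1 : ℤ), ([] : List ℕ))]) (const [])

/-- `rowU` is primitive recursive in `(n, P)`. [folklore] -/
theorem primrec_rowU : Primrec fun p : ℕ × ExpPolyCode => rowU p.1 p.2 := by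
  unfold rowU uIdx
  refine list_append.comp (primrec_liftCode.comp (pair fst (pair
    (nat_add.comp (nat_mul.comp fst fst) (const 3)) snd))) ?_
  exact primrec_mulVarCode.comp (pair (primrec_certDim.comp fst) (pair
    (nat_add.comp fst (nat_mul.comp fst fst)) (const [((-1 : ℤ), ([] : List ℕ))])))

/-- `rowW` is primitive recursive in `(n, η)`. [folklore] -/
theorem primrec_rowW : Primrec fun p : ℕ × ℕ => rowW p.1 p.2 := by
  unfold rowW uIdx wIdx
  refine list_append.comp ?_ ?_
  · refine primrec_mulVarCode.comp (pair (primrec_certDim.comp fst) (pair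
      (nat_add.comp fst (nat_mul.comp fst fst)) ?_))
    exact list_map (list_range.comp snd) (const ((1 : ℤ), ([] : List ℕ))).to₂
  · exact primrec_mulVarCode.comp (pair (primrec_certDim.comp fst) (pair
      (nat_add.comp fst (nat_add.comp (nat_mul.comp fst fst) (const 1))) (const [((-1 : ℤ), ([] : List ℕ))])))

/-- `rowT` is primitive recursive in `n`. [folklore] -/
theorem primrec_rowT : Primrec fun n : ℕ => rowT n := by
  unfold rowT tIdx wIdx
  have hN := primrec_certDim
  have ht : Primrec fun n : ℕ => n + (n * n + 2) :=
    nat_add.comp Primrec.id (nat_add.comp (nat_mul.comp Primrec.id Primrec.id) (const 2))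
  have hw : Primrec fun n : ℕ => n + (n * n + 1) :=
    nat_add.comp Primrec.id (nat_add.comp (nat_mul.comp Primrec.id Primrec.id) (const 1))
  have mv : ∀ {v c : ℕ → _}, Primrec v → Primrec c →
      Primrec fun n : ℕ => mulVarCode (n + (n * n + 3)) (v n) (c n) := fun hv hc =>
    primrec_mulVarCode.comp (pair hN (pair hv hc))
  refine list_append.comp (list_append.comp (mv ht (mv ht (const _))) (mv ht (mv ht (mv hw (mv hw (const _))))))
    (const _)

/-- `certRow` is primitive recursive in `(n, F, P, η, r)`. [folklore] -/
theorem primrec_certRow :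
    Primrec fun p : (ℕ × List ExpPolyCode × ExpPolyCode × ℕ) × ℕ => certRow p.1.1 p.1.2.1 p.1.2.2.1 p.1.2.2.2 p.2 := by
  unfold certRow
  have hn : Primrec fun p : (ℕ × List ExpPolyCode × ExpPolyCode × ℕ) × ℕ => p.1.1 := fst.comp fst
  have hF : Primrec fun p : (ℕ × List ExpPolyCode × ExpPolyCode × ℕ) × ℕ => p.1.2.1 := fst.comp (snd.comp fst)
  have hP : Primrec fun p : (ℕ × List ExpPolyCode × ExpPolyCode × ℕ) × ℕ => p.1.2.2.1 :=
    fst.comp (snd.comp (snd.comp fst))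
  have hη : Primrec fun p : (ℕ × List ExpPolyCode × ExpPolyCode × ℕ) × ℕ => p.1.2.2.2 :=
    snd.comp (snd.comp (snd.comp fst))
  have hr : Primrec fun p : (ℕ × List ExpPolyCode × ExpPolyCode × ℕ) × ℕ => p.2 := snd
  have hnn : Primrec fun p : (ℕ × List ExpPolyCode × ExpPolyCode × ℕ) × ℕ => p.1.1 * p.1.1 := nat_mul.comp hn hn
  refine ite (nat_lt.comp hr hn) (primrec_rowF.comp (pair (pair hn hF) hr)) ?_
  refine ite (nat_lt.comp hr (nat_add.comp hn hnn))
    (primrec_rowB.comp (pair (pair hn hF) (pair (nat_div.comp (nat_sub.comp hr hn) hn)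
      (nat_mod.comp (nat_sub.comp hr hn) hn)))) ?_
  refine ite (Primrec.eq.comp hr (nat_add.comp hn hnn)) (primrec_rowU.comp (pair hn hP)) ?_
  refine ite (Primrec.eq.comp hr (nat_add.comp hn (nat_add.comp hnn (const 1)))) (primrec_rowW.comp (pair hn hη)) ?_
  exact primrec_rowT.comp hn

/-- **The certificate system is primitive recursive** in `(n, F, P, η)`. [folklore] -/
theorem primrec_certCode :
    Primrec fun p : ℕ × List ExpPolyCode × ExpPolyCode × ℕ => certCode p.1 p.2.1 p.2.2.1 p.2.2.2 := by
  unfold certCode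
  exact list_map (list_range.comp (primrec_certDim.comp fst)) primrec_certRow.to₂

end Computability

end ExpPolyCode

end Literature.ModelTheory.ExponentialFields

end
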